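import Mathlib
import Summits.Ventures.PercRepro2.RootPairSep

/-!
# Series reduction: an unmarked vertex of degree two is absorbed into one edge
(blind cell PercRepro2, mine-2 g21; proofs/MINE2-CUTU.md Lemma 11.4 «2-terminal pieces = edges», the
series case).

Let `w` be a vertex whose only incident edges are `e₁ = {x, w}` and `e₂ = {w, y}`.  Replace both by
the edge `{x, y}` (the new edge map sends `e₁` and `e₂` to `s(x, y)`) and give `e₁` the weight
`p e₁ * p e₂` and `e₂` the weight `0`.  For every event that only looks at connections between
vertices other than `w`, the probability is unchanged (`prob_series`): on `{e₁, e₂ both open}` the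
path `x – w – y` is the open edge `{x, y}` (`conn_series_both_open`), and otherwise `w` is a dead end
(`conn_series_not_both`).  The probabilities are assembled with the pin identity `prob_eq_pin`.
Hence every certificate for a skeleton applies to all its subdivisions: the composite weight of a
path of unmarked degree-two vertices is the product of its edge weights.
-/

namespace Summit.Ventures.PercRepro2

namespace Series

open SepPair

section Graph

variable {V : Type*} {E : Type*} [DecidableEq E]

/-- In the reduced graph `e₁` is the edge `{x, y}`. -/
lemma seriesEnds_e₁ (ends : E → Sym2 V) {e₁ e₂ : E} (he : e₁ ≠ e₂) (x y : V) :
    Function.update (Function.update ends e₁ s(x, y)) e₂ s(x, y) e₁ = s(x, y) := by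
  simp [Function.update_of_ne he]

/-- In the reduced graph `e₂` is (a second copy of) the edge `{x, y}`. -/
lemma seriesEnds_e₂ (ends : E → Sym2 V) (e₁ e₂ : E) (x y : V) :
    Function.update (Function.update ends e₁ s(x, y)) e₂ s(x, y) e₂ = s(x, y) := by
  simp

/-- Every other edge of the reduced graph is unchanged. -/
lemma seriesEnds_of_ne (ends : E → Sym2 V) {e₁ e₂ e : E} (h₁ : e ≠ e₁) (h₂ : e ≠ e₂) (x y : V) :
    Function.update (Function.update ends e₁ s(x, y)) e₂ s(x, y) e = ends e := by
  simp [Function.update_of_ne h₁, Function.update_of_ne h₂]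

variable {ends : E → Sym2 V} {e₁ e₂ : E} {x w y : V}

omit [DecidableEq E] in
/-- An edge other than `e₁, e₂` avoids `w` (series hypothesis: `w` is met only by `e₁`, `e₂`). -/
lemma series_other (honly : ∀ e, e ≠ e₁ → e ≠ e₂ → w ∉ ends e) {e : E} (h₁ : e ≠ e₁) (h₂ : e ≠ e₂)
    {z z' : V} (hends : ends e = s(z, z')) : z ≠ w ∧ z' ≠ w := by
  have hw := honly e h₁ h₂
  rw [hends, Sym2.mem_iff] at hw
  exact ⟨fun h => hw (Or.inl h.symm), fun h => hw (Or.inr h.symm)⟩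

/-- **Both edges open.**  Connections between vertices other than `w` are the same in `G` under `ω`
and in `G'` under `ω` with `e₂` closed. -/
lemma conn_series_both_open (hne : e₁ ≠ e₂) (hends₁ : ends e₁ = s(x, w)) (hends₂ : ends e₂ = s(w, y))
    (hxw : x ≠ w) (hyw : y ≠ w) (honly : ∀ e, e ≠ e₁ → e ≠ e₂ → w ∉ ends e) {ω : Config E}
    (ho₁ : ω e₁ = true) (ho₂ : ω e₂ = true) {u v : V} (hu : u ≠ w) (hv : v ≠ w) :
    Conn ends ω u v ↔ Conn (Function.update (Function.update ends e₁ s(x, y)) e₂ s(x, y)) (Function.update ω e₂ false) u v := by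
  set ends' := Function.update (Function.update ends e₁ s(x, y)) e₂ s(x, y) with hends'
  set ω' := Function.update ω e₂ false with hω'
  have hω'₁ : ω' e₁ = true := by rw [hω', Function.update_of_ne hne]; exact ho₁
  have hxy : Conn ends' ω' x y :=
    conn_of_openAdj ⟨e₁, hω'₁, seriesEnds_e₁ ends hne x y⟩
  constructor
  · intro h
    let S : Set V := {z | (z ≠ w ∧ Conn ends' ω' u z) ∨ (z = w ∧ Conn ends' ω' u x)}
    have huS : u ∈ S := Or.inl ⟨hu, conn_refl _ _ _⟩
    have hclosed : ∀ e z z', ω e = true → ends e = s(z, z') → z ∈ S → z' ∈ S := by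
      intro e z z' he hends hzS
      by_cases h₁ : e = e₁
      · subst h₁
        rcases Sym2.eq_iff.1 (hends₁.symm.trans hends) with ⟨rfl, rfl⟩ | ⟨rfl, rfl⟩
        · -- from `x` to `w`
          rcases hzS with ⟨_, hc⟩ | ⟨hzw, _⟩
          · exact Or.inr ⟨rfl, hc⟩
          · exact absurd hzw hxw
        · -- from `w` to `x`
          rcases hzS with ⟨hzw, _⟩ | ⟨_, hc⟩
          · exact absurd rfl hzw
          · exact Or.inl ⟨hxw, hc⟩
      · by_cases h₂ : e = e₂
        · subst h₂
          rcases Sym2.eq_iff.1 (hends₂.symm.trans hends) with ⟨rfl, rfl⟩ | ⟨rfl, rfl⟩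
          · -- from `w` to `y`
            rcases hzS with ⟨hzw, _⟩ | ⟨_, hc⟩
            · exact absurd rfl hzw
            · exact Or.inl ⟨hyw, conn_trans hc hxy⟩
          · -- from `y` to `w`
            rcases hzS with ⟨_, hc⟩ | ⟨hzw, _⟩
            · exact Or.inr ⟨rfl, conn_trans hc (conn_symm hxy)⟩
            · exact absurd hzw hyw
        · obtain ⟨hz, hz'⟩ := series_other honly h₁ h₂ hends
          rcases hzS with ⟨_, hc⟩ | ⟨hzw, _⟩
          · have he' : ω' e = true := by rw [hω', Function.update_of_ne h₂]; exact he
            have hends' : ends' e = s(z, z') := by rw [hends', seriesEnds_of_ne ends h₁ h₂]; exact hends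
            exact Or.inl ⟨hz', conn_trans hc (conn_of_openAdj ⟨e, he', hends'⟩)⟩
          · exact absurd hzw hz
    have hvS : v ∈ S := mem_of_conn_of_closed' hclosed huS h
    rcases hvS with ⟨_, hc⟩ | ⟨hvw, _⟩
    · exact hc
    · exact absurd hvw hv
  · intro h
    let S : Set V := {z | Conn ends ω u z}
    have huS : u ∈ S := conn_refl _ _ _
    have hxw : Conn ends ω x w := conn_of_openAdj ⟨e₁, ho₁, hends₁⟩
    have hwy : Conn ends ω w y := conn_of_openAdj ⟨e₂, ho₂, hends₂⟩
    have hclosed : ∀ e z z', ω' e = true → ends' e = s(z, z') → z ∈ S → z' ∈ S := by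
      intro e z z' he hends hzS
      by_cases h₁ : e = e₁
      · subst h₁
        rw [hends', seriesEnds_e₁ ends hne] at hends
        rcases Sym2.eq_iff.1 hends.symm with ⟨rfl, rfl⟩ | ⟨rfl, rfl⟩
        · exact conn_trans hzS (conn_trans hxw hwy)
        · exact conn_trans hzS (conn_symm (conn_trans hxw hwy))
      · by_cases h₂ : e = e₂
        · subst h₂
          rw [hω', Function.update_self] at he
          exact absurd he Bool.false_ne_true
        · have he' : ω e = true := by rw [hω', Function.update_of_ne h₂] at he; exact he
          have hends₀ : ends e = s(z, z') := by rw [hends', seriesEnds_of_ne ends h₁ h₂] at hends; exact hends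
          exact conn_trans hzS (conn_of_openAdj ⟨e, he', hends₀⟩)
    exact mem_of_conn_of_closed' hclosed huS h

/-- **Not both open.**  Connections between vertices other than `w` are the same in `G` under `ω`
and in `G'` under `ω` with both `e₁`, `e₂` closed. -/
lemma conn_series_not_both (hne : e₁ ≠ e₂) (hends₁ : ends e₁ = s(x, w)) (hends₂ : ends e₂ = s(w, y))
    (hxw : x ≠ w) (hyw : y ≠ w) (honly : ∀ e, e ≠ e₁ → e ≠ e₂ → w ∉ ends e) {ω : Config E}
    (hno : ¬ (ω e₁ = true ∧ ω e₂ = true)) {u v : V} (hu : u ≠ w) (hv : v ≠ w) :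
    Conn ends ω u v ↔
      Conn (Function.update (Function.update ends e₁ s(x, y)) e₂ s(x, y)) (Function.update (Function.update ω e₁ false) e₂ false) u v := by
  set ends' := Function.update (Function.update ends e₁ s(x, y)) e₂ s(x, y) with hends'
  set ω' := Function.update (Function.update ω e₁ false) e₂ false with hω'
  have hω'₁ : ω' e₁ = false := by
    rw [hω', Function.update_of_ne hne, Function.update_self]
  have hω'₂ : ω' e₂ = false := by rw [hω', Function.update_self]
  constructor
  · intro h
    let S : Set V := {z | (z ≠ w ∧ Conn ends' ω' u z) ∨
      (z = w ∧ ((ω e₁ = true ∧ Conn ends' ω' u x) ∨ (ω e₂ = true ∧ Conn ends' ω' u y)))}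
    have huS : u ∈ S := Or.inl ⟨hu, conn_refl _ _ _⟩
    have hclosed : ∀ e z z', ω e = true → ends e = s(z, z') → z ∈ S → z' ∈ S := by
      intro e z z' he hends hzS
      by_cases h₁ : e = e₁
      · subst h₁
        rcases Sym2.eq_iff.1 (hends₁.symm.trans hends) with ⟨rfl, rfl⟩ | ⟨rfl, rfl⟩
        · rcases hzS with ⟨_, hc⟩ | ⟨hzw, _⟩
          · exact Or.inr ⟨rfl, Or.inl ⟨he, hc⟩⟩
          · exact absurd hzw hxw
        · rcases hzS with ⟨hzw, _⟩ | ⟨_, ⟨_, hc⟩ | ⟨ho₂, _⟩⟩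
          · exact absurd rfl hzw
          · exact Or.inl ⟨hxw, hc⟩
          · exact absurd ⟨he, ho₂⟩ hno
      · by_cases h₂ : e = e₂
        · subst h₂
          rcases Sym2.eq_iff.1 (hends₂.symm.trans hends) with ⟨rfl, rfl⟩ | ⟨rfl, rfl⟩
          · rcases hzS with ⟨hzw, _⟩ | ⟨_, ⟨ho₁, _⟩ | ⟨_, hc⟩⟩
            · exact absurd rfl hzw
            · exact absurd ⟨ho₁, he⟩ hno
            · exact Or.inl ⟨hyw, hc⟩
          · rcases hzS with ⟨_, hc⟩ | ⟨hzw, _⟩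
            · exact Or.inr ⟨rfl, Or.inr ⟨he, hc⟩⟩
            · exact absurd hzw hyw
        · obtain ⟨hz, hz'⟩ := series_other honly h₁ h₂ hends
          rcases hzS with ⟨_, hc⟩ | ⟨hzw, _⟩
          · have he' : ω' e = true := by
              rw [hω', Function.update_of_ne h₂, Function.update_of_ne h₁]; exact he
            have hends' : ends' e = s(z, z') := by rw [hends', seriesEnds_of_ne ends h₁ h₂]; exact hends
            exact Or.inl ⟨hz', conn_trans hc (conn_of_openAdj ⟨e, he', hends'⟩)⟩
          · exact absurd hzw hz
    have hvS : v ∈ S := mem_of_conn_of_closed' hclosed huS h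
    rcases hvS with ⟨_, hc⟩ | ⟨hvw, _⟩
    · exact hc
    · exact absurd hvw hv
  · intro h
    let S : Set V := {z | Conn ends ω u z}
    have huS : u ∈ S := conn_refl _ _ _
    have hclosed : ∀ e z z', ω' e = true → ends' e = s(z, z') → z ∈ S → z' ∈ S := by
      intro e z z' he hends hzS
      by_cases h₁ : e = e₁
      · subst h₁; rw [hω'₁] at he; exact absurd he Bool.false_ne_true
      · by_cases h₂ : e = e₂
        · subst h₂; rw [hω'₂] at he; exact absurd he Bool.false_ne_true
        · have he' : ω e = true := by
            rw [hω', Function.update_of_ne h₂, Function.update_of_ne h₁] at he; exact he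
          have hends₀ : ends e = s(z, z') := by rw [hends', seriesEnds_of_ne ends h₁ h₂] at hends; exact hends
          exact conn_trans hzS (conn_of_openAdj ⟨e, he', hends₀⟩)
    exact mem_of_conn_of_closed' hclosed huS h

end Graph

section Prob

variable {V : Type*} {E : Type*} [Fintype E] [DecidableEq E] {R : Type*} [CommRing R]

/-- A probability with `e` pinned open is the probability of the event read at `ω[e := true]`. -/
lemma prob_update_one (p : E → R) (e : E) (A : Set (Config E)) :
    prob (Function.update p e 1) A = prob p {ω | Function.update ω e true ∈ A} := by
  rw [prob_eq_expect_indicator, prob_eq_expect_indicator, expect_update_one]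
  rfl

/-- A probability with `e` pinned closed is the probability of the event read at `ω[e := false]`. -/
lemma prob_update_zero (p : E → R) (e : E) (A : Set (Config E)) :
    prob (Function.update p e 0) A = prob p {ω | Function.update ω e false ∈ A} := by
  rw [prob_eq_expect_indicator, prob_eq_expect_indicator, expect_update_zero]
  rfl

variable {ends : E → Sym2 V} {e₁ e₂ : E} {x w y : V}

/-- **Series reduction.**  For an event that only looks at connections between vertices other than
`w`, the probability in `G` equals the probability in the reduced graph with the series weights. -/
theorem prob_series (hne : e₁ ≠ e₂) (hends₁ : ends e₁ = s(x, w)) (hends₂ : ends e₂ = s(w, y))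
    (hxw : x ≠ w) (hyw : y ≠ w) (honly : ∀ e, e ≠ e₁ → e ≠ e₂ → w ∉ ends e) (p : E → R) (P : (V → V → Prop) → Prop)
    (hP : ∀ r r' : V → V → Prop, (∀ u v, u ≠ w → v ≠ w → (r u v ↔ r' u v)) → (P r ↔ P r')) :
    prob p {ω | P (Conn ends ω)} =
      prob (Function.update (Function.update p e₁ (p e₁ * p e₂)) e₂ 0) {ω | P (Conn (Function.update (Function.update ends e₁ s(x, y)) e₂ s(x, y)) ω)} := by
  have hne' : e₂ ≠ e₁ := hne.symm
  set ends' := Function.update (Function.update ends e₁ s(x, y)) e₂ s(x, y) with hends'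
  set X := {ω : Config E | P (Conn ends ω)} with hX
  set X' := {ω : Config E | P (Conn ends' ω)} with hX'
  -- the pointwise identifications
  have key11 : {ω : Config E | Function.update (Function.update ω e₁ true) e₂ true ∈ X} =
      {ω | Function.update (Function.update ω e₁ true) e₂ false ∈ X'} := by
    ext ω
    simp only [hX, hX', Set.mem_setOf_eq]
    have h : ∀ u v : V, u ≠ w → v ≠ w →
        (Conn ends (Function.update (Function.update ω e₁ true) e₂ true) u v ↔
          Conn ends' (Function.update (Function.update (Function.update ω e₁ true) e₂ true) e₂ false)
            u v) :=
      fun u v hu hv => conn_series_both_open hne hends₁ hends₂ hxw hyw honly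
        (by rw [Function.update_of_ne hne, Function.update_self]) (by rw [Function.update_self]) hu hv
    rw [Function.update_idem] at h
    exact hP _ _ h
  have keyno : ∀ a b : Bool, ¬ (a = true ∧ b = true) →
      {ω : Config E | Function.update (Function.update ω e₁ a) e₂ b ∈ X} =
        {ω | Function.update (Function.update ω e₁ false) e₂ false ∈ X'} := by
    intro a b hab
    ext ω
    simp only [hX, hX', Set.mem_setOf_eq]
    have h : ∀ u v : V, u ≠ w → v ≠ w →
        (Conn ends (Function.update (Function.update ω e₁ a) e₂ b) u v ↔
          Conn ends' (Function.update (Function.update (Function.update (Function.update ω e₁ a) e₂ b)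
            e₁ false) e₂ false) u v) :=
      fun u v hu hv => conn_series_not_both hne hends₁ hends₂ hxw hyw honly
        (by rw [Function.update_of_ne hne, Function.update_self, Function.update_self]; exact hab) hu hv
    have e : Function.update (Function.update (Function.update (Function.update ω e₁ a) e₂ b) e₁ false)
        e₂ false = Function.update (Function.update ω e₁ false) e₂ false := by
      funext e
      by_cases h₂ : e = e₂
      · simp [h₂]
      · by_cases h₁ : e = e₁
        · simp [h₁, Function.update_of_ne hne]
        · simp [Function.update_of_ne h₁, Function.update_of_ne h₂]
    rw [e] at h
    exact hP _ _ h
  -- pinned probabilities as probabilities of updated events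
  have T : ∀ (a b : Bool) (A : Set (Config E)),
      prob (Function.update (Function.update p e₁ (if a then 1 else 0)) e₂ (if b then 1 else 0)) A =
        prob p {ω | Function.update (Function.update ω e₁ a) e₂ b ∈ A} := by
    intro a b A
    cases a <;> cases b <;>
      simp only [Bool.false_eq_true, ↓reduceIte] <;>
      first
        | (rw [prob_update_zero, prob_update_zero]; rfl)
        | (rw [prob_update_zero, prob_update_one]; rfl)
        | (rw [prob_update_one, prob_update_zero]; rfl)
        | (rw [prob_update_one, prob_update_one]; rfl)
  have T11 := T true true X
  have T10 := T true false X
  have T01 := T false true X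
  have T00 := T false false X
  have T'10 := T true false X'
  have T'00 := T false false X'
  simp only [Bool.false_eq_true, ↓reduceIte] at T11 T10 T01 T00 T'10 T'00
  -- the left side
  have L1 : prob (Function.update p e₁ 1) X =
      p e₂ * prob (Function.update (Function.update p e₁ 1) e₂ 1) X +
        (1 - p e₂) * prob (Function.update (Function.update p e₁ 1) e₂ 0) X := by
    have h := prob_eq_pin (Function.update p e₁ 1) X e₂
    rwa [Function.update_of_ne hne'] at h
  have L0 : prob (Function.update p e₁ 0) X =
      p e₂ * prob (Function.update (Function.update p e₁ 0) e₂ 1) X +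
        (1 - p e₂) * prob (Function.update (Function.update p e₁ 0) e₂ 0) X := by
    have h := prob_eq_pin (Function.update p e₁ 0) X e₂
    rwa [Function.update_of_ne hne'] at h
  have LHS : prob p X = p e₁ * (p e₂ * prob p {ω | Function.update (Function.update ω e₁ true) e₂ true ∈ X} +
        (1 - p e₂) * prob p {ω | Function.update (Function.update ω e₁ true) e₂ false ∈ X}) +
      (1 - p e₁) * (p e₂ * prob p {ω | Function.update (Function.update ω e₁ false) e₂ true ∈ X} +
        (1 - p e₂) * prob p {ω | Function.update (Function.update ω e₁ false) e₂ false ∈ X}) := by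
    rw [prob_eq_pin p X e₁, L1, L0, T11, T10, T01, T00]
  -- the right side
  set p' := Function.update (Function.update p e₁ (p e₁ * p e₂)) e₂ 0 with hp'
  have hp'₁ : p' e₁ = p e₁ * p e₂ := by
    rw [hp', Function.update_of_ne hne, Function.update_self]
  have hp'₂ : p' e₂ = 0 := by rw [hp', Function.update_self]
  have upd : ∀ a : R, Function.update (Function.update p' e₁ a) e₂ 0 =
      Function.update (Function.update p e₁ a) e₂ 0 := by
    intro a
    funext e
    by_cases h₂ : e = e₂
    · simp [h₂]
    · by_cases h₁ : e = e₁
      · simp [h₁, Function.update_of_ne hne]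
      · simp [hp', Function.update_of_ne h₁, Function.update_of_ne h₂]
  have R1 : prob (Function.update p' e₁ 1) X' = prob p {ω | Function.update (Function.update ω e₁ true) e₂ false ∈ X'} := by
    have h := prob_eq_pin (Function.update p' e₁ 1) X' e₂
    rw [Function.update_of_ne hne', hp'₂, upd, T'10] at h
    rw [h]; ring
  have R0 : prob (Function.update p' e₁ 0) X' = prob p {ω | Function.update (Function.update ω e₁ false) e₂ false ∈ X'} := by
    have h := prob_eq_pin (Function.update p' e₁ 0) X' e₂
    rw [Function.update_of_ne hne', hp'₂, upd, T'00] at h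
    rw [h]; ring
  have RHS : prob p' X' = p e₁ * p e₂ * prob p {ω | Function.update (Function.update ω e₁ true) e₂ false ∈ X'} +
      (1 - p e₁ * p e₂) * prob p {ω | Function.update (Function.update ω e₁ false) e₂ false ∈ X'} := by
    rw [prob_eq_pin p' X' e₁, hp'₁, R1, R0]
  rw [LHS, RHS, key11, keyno true false (by simp), keyno false true (by simp), keyno false false (by simp)]
  ring

end Prob

end Series

end Summit.Ventures.PercRepro2
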